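import Summits.AtomisticToContinuum.FouriersLaw.Theses.VanishingNoiseTransfer
import Summits.AtomisticToContinuum.FouriersLaw.Theses.FeketeSeriesLaw
import Summits.AtomisticToContinuum.FouriersLaw.Theses.JunctionLocality
import Literature.MathematicalPhysics.KineticTheory.VelocityFlipNoise
import Summits.AtomisticToContinuum.FouriersLaw.Theorems.OddSectorIrreversibilityBoundedResponse

/-!
# `NoiseLocality` (stmt-AtomisticToContinuum-11975) reduced to the uniform two-sided series law — part 1: the transfer and the small lemmas

Importable record of line `fekete-transposed-uniformity` of crux `VanishingNoiseTransfer.NoiseLocality` (lead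
`prover-line-stmt-AtomisticToContinuum-11975-c1-0`, 2026-08-17), split from the planner's kernel-checked skeleton
`Cruxes/NoiseLocality/Lines/fekete_transposed_uniformity.lean` (v3) whose three fixed-`N` stubs are now LANDED theorems
(`…Theorems.NoiseLocality.stub_flipSteadyStateWellPosed`, `…stub_responseContinuousInNoise`, `…stub_positiveNoisyConductance`).
This part: the pure real-analysis transfer `equicontinuity_of_seriesLaw` (two-sided series law on `[0,1]` with ONE constant +
continuity of each `r N` on `[0,1]` ⇒ an `N`-uniform modulus at `0⁺`), the mutation remark `seriesLaw_without_continuity_insufficient`,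
and the small lemmas (`N ≤ 1` currentless; closure of a bound from `(0,1]` to `[0,1]`). Part 2 (`…FeketeReduction`) composes them
with the landed stubs into `noiseLocality_of_uniformSeriesLaw : (stub 4 text) → NoiseLocality`. No definitions; nothing closes an item.
-/

noncomputable section

namespace Summit.AtomisticToContinuum.FouriersLaw.Theorems.NoiseLocality.FeketeReduction

open Filter Topology MeasureTheory
open Literature.MathematicalPhysics.KineticTheory.HeatConduction

/-! ## Registered stubs

Shape (D-0027 §3.3; required by the `#h21_check_skeleton` by-name hypothesis rule): each stub is a
sorried theorem `Holds.stub_<name> : <full statement> := by sorry` — `ledger skeleton check` registers it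
under `stub_<name>` with THAT header text as signature — plus the by-name handle
`def stub_<name> : Prop := type_of% Holds.stub_<name>` used as hypothesis of `NoiseLocality_of` (an inline
`∀ …` hypothesis is bounced as `skeleton.extra-hypothesis`; dry-run verified on the sibling line).  All
statements are over tree declarations only (`pinnedChain`, `IsFlipSteadyState`, `IsSteadyState`,
`totalCurrent`), fully qualified, so that a prover's `propose --supports stmt-AtomisticToContinuum-11975`
can restate them verbatim in a Theorems file. -/

-- (the four registered stub texts of the skeleton are not re-declared here: stubs 1–3 are the landed theorems
-- `Summit.AtomisticToContinuum.FouriersLaw.Theorems.NoiseLocality.stub_flipSteadyStateWellPosed` / `…stub_responseContinuousInNoise` / `…stub_positiveNoisyConductance`,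
-- and stub 4 — the open N-uniform series law — is an explicit hypothesis `h4` below.)

/-! ## The transfer (PROVED in v3): two-sided series law on `[0,1]` + fixed-`N` continuity ⇒ `N`-uniform modulus -/

/-- **`equicontinuity_of_seriesLaw`** (the card's First lemma, v1/v2's `stub_equicontinuityOfSeriesLaw`; pure real
analysis, now kernel-checked).  If `r N : ℝ → ℝ` is continuous on `[0,1]` for every `N ≥ 2` and the two-sided series
law `|(N+M−1)·r_{N+M}(ε) − (N−1)·r_N(ε) − (M−1)·r_M(ε)| ≤ C` holds for all `ε ∈ [0,1]`, `N, M ≥ 2` with ONE `C`,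
then there is `w → 0` at `0⁺` with `|r_N(ε) − r_N(0)| ≤ w(ε)` for all `N ≥ 2`, `ε ∈ (0,1]`.
Proof: `R_N := (N−1) r_N`; induction gives `|R_{kn} − k R_n| ≤ (k−1)C`, hence `|R_n/n − R_m/m| ≤ C/n + C/m`
(compare both with `R_{nm}/(nm)`); so `R_n(ε)/n` is Cauchy with limit `ℓ(ε)` and `|R_n(ε)/n − ℓ(ε)| ≤ C/n`;
`|ℓ| ≤ B := sup_[0,1]|r_2| + C`; `|r_N − ℓ| ≤ (C + B)/(N−1)` uniformly on `[0,1]`, so `ℓ` is continuous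
(`TendstoUniformlyOn.continuousOn`); `w(ε) := ⨆_N |r_{N∨2}(ε) − r_{N∨2}(0)|` is bounded and `→ 0` at `0⁺` by the
split `N ≥ N₀` / `N < N₀` (same sup/finite-split as Disproof §5b `localityShape_of_parts`). [folklore] -/
theorem equicontinuity_of_seriesLaw :
    ∀ (r : ℕ → ℝ → ℝ) (C : ℝ),
      (∀ N : ℕ, 2 ≤ N → ContinuousOn (r N) (Set.Icc 0 1)) →
      (∀ ε ∈ Set.Icc (0 : ℝ) 1, ∀ N M : ℕ, 2 ≤ N → 2 ≤ M →
        |((N : ℝ) + (M : ℝ) - 1) * r (N + M) ε - ((N : ℝ) - 1) * r N ε - ((M : ℝ) - 1) * r M ε| ≤ C) →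
      ∃ w : ℝ → ℝ, Filter.Tendsto w (nhdsWithin 0 (Set.Ioi 0)) (nhds 0) ∧
        ∀ N : ℕ, 2 ≤ N → ∀ ε : ℝ, 0 < ε → ε ≤ 1 → |r N ε - r N 0| ≤ w ε := by
  intro r C hcont hlaw
  -- resistances `R n ε = (n - 1) r n ε`
  obtain ⟨R, hR⟩ : ∃ R : ℕ → ℝ → ℝ, ∀ n ε, R n ε = ((n : ℝ) - 1) * r n ε := ⟨_, fun _ _ => rfl⟩
  have hlawR : ∀ ε ∈ Set.Icc (0 : ℝ) 1, ∀ N M : ℕ, 2 ≤ N → 2 ≤ M →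
      |R (N + M) ε - R N ε - R M ε| ≤ C := by
    intro ε hε N M hN hM
    rw [hR, hR, hR, Nat.cast_add]
    exact hlaw ε hε N M hN hM
  have h0mem : (0 : ℝ) ∈ Set.Icc (0 : ℝ) 1 := ⟨le_rfl, zero_le_one⟩
  -- `C ≥ 0`
  have hC : 0 ≤ C := (abs_nonneg _).trans (hlawR 0 h0mem 2 2 le_rfl le_rfl)
  -- (B) multiples: `|R (k n) - k R n| ≤ (k - 1) C`
  have hmul : ∀ ε ∈ Set.Icc (0 : ℝ) 1, ∀ n : ℕ, 2 ≤ n → ∀ k : ℕ, 1 ≤ k →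
      |R (k * n) ε - k * R n ε| ≤ ((k : ℝ) - 1) * C := by
    intro ε hε n hn k hk
    induction k, hk using Nat.le_induction with
    | base => simp
    | succ k hk ih =>
      have hkn : 2 ≤ k * n := le_trans hn (Nat.le_mul_of_pos_left n hk)
      have h1 := hlawR ε hε (k * n) n hkn hn
      have e : (k + 1) * n = k * n + n := by ring
      rw [e]
      push_cast
      have hsplit : R (k * n + n) ε - ((k : ℝ) + 1) * R n ε
          = (R (k * n + n) ε - R (k * n) ε - R n ε) + (R (k * n) ε - (k : ℝ) * R n ε) := by ring
      rw [hsplit]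
      calc |R (k * n + n) ε - R (k * n) ε - R n ε + (R (k * n) ε - (k : ℝ) * R n ε)|
          ≤ |R (k * n + n) ε - R (k * n) ε - R n ε| + |R (k * n) ε - (k : ℝ) * R n ε| :=
            abs_add_le _ _
        _ ≤ C + ((k : ℝ) - 1) * C := add_le_add h1 ih
        _ = ((k : ℝ) + 1 - 1) * C := by ring
  -- (C) comparison: `|R n / n - R m / m| ≤ C/n + C/m`
  have hcmp : ∀ ε ∈ Set.Icc (0 : ℝ) 1, ∀ n m : ℕ, 2 ≤ n → 2 ≤ m →
      |R n ε / n - R m ε / m| ≤ C / n + C / m := by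
    intro ε hε n m hn hm
    have hn0 : (0 : ℝ) < n := by exact_mod_cast (show 0 < n by omega)
    have hm0 : (0 : ℝ) < m := by exact_mod_cast (show 0 < m by omega)
    have h1 := hmul ε hε n hn m (by omega)      -- |R (m*n) - m R n| ≤ (m-1) C
    have h2 := hmul ε hε m hm n (by omega)      -- |R (n*m) - n R m| ≤ (n-1) C
    rw [Nat.mul_comm n m] at h2
    have k1 : |R (m * n) ε / ((m : ℝ) * n) - R n ε / n| ≤ C / n := by
      have e1 : R (m * n) ε / ((m : ℝ) * n) - R n ε / n = (R (m * n) ε - m * R n ε) / ((m : ℝ) * n) := by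
        field_simp
      rw [e1, abs_div, abs_of_pos (mul_pos hm0 hn0), div_le_div_iff₀ (mul_pos hm0 hn0) hn0]
      have : ((m : ℝ) - 1) * C * n ≤ C * ((m : ℝ) * n) := by nlinarith
      nlinarith [h1, abs_nonneg (R (m * n) ε - m * R n ε)]
    have k2 : |R (m * n) ε / ((m : ℝ) * n) - R m ε / m| ≤ C / m := by
      have e2 : R (m * n) ε / ((m : ℝ) * n) - R m ε / m = (R (m * n) ε - n * R m ε) / ((m : ℝ) * n) := by
        field_simp
      rw [e2, abs_div, abs_of_pos (mul_pos hm0 hn0), div_le_div_iff₀ (mul_pos hm0 hn0) hm0]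
      have : ((n : ℝ) - 1) * C * m ≤ C * ((m : ℝ) * n) := by nlinarith
      nlinarith [h2, abs_nonneg (R (m * n) ε - n * R m ε)]
    calc |R n ε / n - R m ε / m|
        ≤ |R n ε / n - R (m * n) ε / ((m : ℝ) * n)| + |R (m * n) ε / ((m : ℝ) * n) - R m ε / m| :=
          abs_sub_le _ _ _
      _ ≤ C / n + C / m := by
          rw [abs_sub_comm] at k1
          exact add_le_add k1 k2
  -- (D) the limit `ℓ ε` of `R n ε / n`
  have hlim : ∀ ε ∈ Set.Icc (0 : ℝ) 1, ∃ a : ℝ, Tendsto (fun m : ℕ => R m ε / m) atTop (𝓝 a) := by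
    intro ε hε
    have hcs : CauchySeq (fun m : ℕ => R (m + 2) ε / ((m + 2 : ℕ) : ℝ)) := by
      refine cauchySeq_of_le_tendsto_0 (fun N : ℕ => 2 * C / ((N + 2 : ℕ) : ℝ)) (fun n m N hn hm => ?_) ?_
      · rw [Real.dist_eq]
        have h := hcmp ε hε (n + 2) (m + 2) (by omega) (by omega)
        have hN0 : (0 : ℝ) < ((N + 2 : ℕ) : ℝ) := by positivity
        have ha : C / ((n + 2 : ℕ) : ℝ) ≤ C / ((N + 2 : ℕ) : ℝ) :=
          div_le_div_of_nonneg_left hC hN0 (by exact_mod_cast (by omega : N + 2 ≤ n + 2))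
        have hb : C / ((m + 2 : ℕ) : ℝ) ≤ C / ((N + 2 : ℕ) : ℝ) :=
          div_le_div_of_nonneg_left hC hN0 (by exact_mod_cast (by omega : N + 2 ≤ m + 2))
        calc |R (n + 2) ε / ((n + 2 : ℕ) : ℝ) - R (m + 2) ε / ((m + 2 : ℕ) : ℝ)|
            ≤ C / ((n + 2 : ℕ) : ℝ) + C / ((m + 2 : ℕ) : ℝ) := h
          _ ≤ 2 * C / ((N + 2 : ℕ) : ℝ) := by rw [two_mul, add_div]; exact add_le_add ha hb
      · exact (tendsto_add_atTop_iff_nat 2).2 (tendsto_const_div_atTop_nhds_zero_nat (2 * C))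
    obtain ⟨a, ha⟩ := cauchySeq_tendsto_of_complete hcs
    exact ⟨a, (tendsto_add_atTop_iff_nat 2).1 ha⟩
  choose! ℓ hℓ using hlim
  -- (E) rate: `|R n / n - ℓ| ≤ C / n`
  have hrate : ∀ ε ∈ Set.Icc (0 : ℝ) 1, ∀ n : ℕ, 2 ≤ n → |R n ε / n - ℓ ε| ≤ C / n := by
    intro ε hε n hn
    have hf : Tendsto (fun m : ℕ => |R n ε / n - R m ε / m|) atTop (𝓝 |R n ε / n - ℓ ε|) :=
      (tendsto_const_nhds.sub (hℓ ε hε)).abs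
    have hg : Tendsto (fun m : ℕ => C / n + C / (m : ℝ)) atTop (𝓝 (C / n)) := by
      simpa using tendsto_const_nhds.add (tendsto_const_div_atTop_nhds_zero_nat C)
    refine le_of_tendsto_of_tendsto hf hg ?_
    filter_upwards [eventually_ge_atTop 2] with m hm
    exact hcmp ε hε n m hn hm
  -- (F) bound on `ℓ`
  obtain ⟨S, hS⟩ := isCompact_Icc.exists_bound_of_continuousOn (hcont 2 le_rfl)
  have hS0 : 0 ≤ S := (norm_nonneg _).trans (hS 0 h0mem)
  set B : ℝ := S + C with hB
  have hℓB : ∀ ε ∈ Set.Icc (0 : ℝ) 1, |ℓ ε| ≤ B := by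
    intro ε hε
    have h := hrate ε hε 2 le_rfl
    have e : R 2 ε = r 2 ε := by rw [hR]; norm_num
    rw [e] at h
    have h2 : ‖r 2 ε‖ ≤ S := hS ε hε
    rw [Real.norm_eq_abs] at h2
    have : |ℓ ε| ≤ |r 2 ε / 2| + C / 2 := by
      have := abs_sub_abs_le_abs_sub (ℓ ε) (r 2 ε / 2)
      rw [abs_sub_comm] at h
      push_cast at h
      linarith
    rw [abs_div, abs_two] at this
    rw [hB]
    linarith
  -- (G) uniform rate: `|r n ε - ℓ ε| ≤ (C + B)/(n - 1)`
  have hCB : 0 ≤ C + B := by rw [hB]; linarith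
  have hunifrate : ∀ ε ∈ Set.Icc (0 : ℝ) 1, ∀ n : ℕ, 2 ≤ n → |r n ε - ℓ ε| ≤ (C + B) / ((n : ℝ) - 1) := by
    intro ε hε n hn
    have hn0 : (0 : ℝ) < n := by exact_mod_cast (show 0 < n by omega)
    have hn1 : (0 : ℝ) < (n : ℝ) - 1 := by
      have : (2 : ℝ) ≤ n := by exact_mod_cast hn
      linarith
    have h := hrate ε hε n hn
    -- |R n ε - n ℓ| ≤ C
    have h' : |R n ε - n * ℓ ε| ≤ C := by
      have e : R n ε - n * ℓ ε = (R n ε / n - ℓ ε) * n := by field_simp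
      rw [e, abs_mul, abs_of_pos hn0]
      calc |R n ε / n - ℓ ε| * n ≤ C / n * n := by gcongr
        _ = C := by field_simp
    rw [hR] at h'
    have e2 : ((n : ℝ) - 1) * (r n ε - ℓ ε) = (((n : ℝ) - 1) * r n ε - n * ℓ ε) + ℓ ε := by ring
    have h3 : |((n : ℝ) - 1) * (r n ε - ℓ ε)| ≤ C + B := by
      rw [e2]
      exact (abs_add_le _ _).trans (add_le_add h' (hℓB ε hε))
    rw [abs_mul, abs_of_pos hn1] at h3
    rw [le_div_iff₀ hn1]
    linarith
  -- (H) `ℓ` is continuous on `[0,1]`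
  have hℓcont : ContinuousOn ℓ (Set.Icc 0 1) := by
    have hunif : TendstoUniformlyOn (fun n => r n) ℓ atTop (Set.Icc 0 1) := by
      refine Metric.tendstoUniformlyOn_iff.2 fun η hη => ?_
      obtain ⟨K, hK⟩ := exists_nat_gt ((C + B) / η)
      filter_upwards [eventually_ge_atTop (K + 2)] with n hn x hx
      rw [Real.dist_eq, abs_sub_comm]
      have hn1 : (0 : ℝ) < (n : ℝ) - 1 := by
        have : ((K + 2 : ℕ) : ℝ) ≤ n := by exact_mod_cast hn
        push_cast at this
        linarith
      refine (hunifrate x hx n (by omega)).trans_lt ?_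
      rw [div_lt_iff₀ hn1]
      have hK' : (K : ℝ) ≤ (n : ℝ) - 2 := by
        have : ((K + 2 : ℕ) : ℝ) ≤ n := by exact_mod_cast hn
        push_cast at this
        linarith
      rw [div_lt_iff₀ hη] at hK
      nlinarith
    exact hunif.continuousOn ((eventually_ge_atTop 2).mono fun n hn => hcont n hn).frequently
  -- (I) the modulus: sup over `N` of the discrepancy table
  set g : ℝ → ℕ → ℝ := fun ε N => |r (max N 2) ε - r (max N 2) 0| with hg
  have g_nonneg : ∀ ε N, 0 ≤ g ε N := fun ε N => abs_nonneg _
  have g_eq : ∀ N : ℕ, 2 ≤ N → ∀ ε, g ε N = |r N ε - r N 0| := by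
    intro N hN ε
    simp only [hg, max_eq_left hN]
  have tail : ∀ η : ℝ, 0 < η → ∃ N₀ : ℕ, ∀ N : ℕ, N₀ ≤ N → ∀ ε ∈ Set.Icc (0 : ℝ) 1,
      g ε N ≤ 2 * η + |ℓ ε - ℓ 0| := by
    intro η hη
    obtain ⟨K, hK⟩ := exists_nat_gt ((C + B) / η)
    refine ⟨K + 2, fun N hN ε hε => ?_⟩
    have hN2 : 2 ≤ N := by omega
    rw [g_eq N hN2]
    have hN1 : (0 : ℝ) < (N : ℝ) - 1 := by
      have : ((K + 2 : ℕ) : ℝ) ≤ N := by exact_mod_cast hN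
      push_cast at this
      linarith
    have hrt : (C + B) / ((N : ℝ) - 1) ≤ η := by
      rw [div_le_iff₀ hN1]
      have hK' : (K : ℝ) ≤ (N : ℝ) - 2 := by
        have : ((K + 2 : ℕ) : ℝ) ≤ N := by exact_mod_cast hN
        push_cast at this
        linarith
      rw [div_lt_iff₀ hη] at hK
      nlinarith
    have a := hunifrate ε hε N hN2
    have b := hunifrate 0 h0mem N hN2
    have t1 : |r N ε - r N 0| ≤ |r N ε - ℓ ε| + |ℓ ε - r N 0| := abs_sub_le _ _ _
    have t2 : |ℓ ε - r N 0| ≤ |ℓ ε - ℓ 0| + |ℓ 0 - r N 0| := abs_sub_le _ _ _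
    rw [abs_sub_comm] at b
    linarith
  have hbdd : ∀ ε ∈ Set.Icc (0 : ℝ) 1, BddAbove (Set.range (g ε)) := by
    intro ε hε
    obtain ⟨N₀, hN₀⟩ := tail 1 one_pos
    have hfin : BddAbove ((g ε) '' Set.Iio N₀) := ((Set.finite_Iio N₀).image _).bddAbove
    have htail : BddAbove ((g ε) '' Set.Ici N₀) :=
      ⟨2 * 1 + |ℓ ε - ℓ 0|, by
        rintro _ ⟨N, hN, rfl⟩
        exact hN₀ N hN ε hε⟩
    refine (hfin.union htail).mono ?_
    rintro _ ⟨N, rfl⟩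
    rcases lt_or_ge N N₀ with hN | hN
    · exact Or.inl ⟨N, hN, rfl⟩
    · exact Or.inr ⟨N, hN, rfl⟩
  -- transfer of limits from `𝓝[Icc 0 1] 0` to `𝓝[>] 0`
  have to_right : ∀ {f : ℝ → ℝ} {a : ℝ}, Tendsto f (𝓝[Set.Icc (0 : ℝ) 1] 0) (𝓝 a) →
      Tendsto f (𝓝[>] (0 : ℝ)) (𝓝 a) := by
    intro f a h
    have h' := h.mono_left (nhdsWithin_mono (0 : ℝ) (Set.Ioc_subset_Icc_self (a := (0 : ℝ)) (b := 1)))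
    rwa [nhdsWithin_Ioc_eq_nhdsGT zero_lt_one] at h'
  refine ⟨fun ε => ⨆ N, g ε N, ?_, fun N hN ε hε hε1 => ?_⟩
  · -- the modulus tends to 0
    refine Metric.tendsto_nhds.mpr fun η hη => ?_
    obtain ⟨N₀, hN₀⟩ := tail (η / 8) (by positivity)
    have hc : ∀ᶠ ε in 𝓝[>] (0 : ℝ), |ℓ ε - ℓ 0| < η / 4 := by
      have hℓ0 : Tendsto ℓ (𝓝[>] (0 : ℝ)) (𝓝 (ℓ 0)) := to_right (hℓcont 0 h0mem)
      have := (Metric.tendsto_nhds.mp hℓ0) (η / 4) (by positivity)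
      simpa only [Real.dist_eq] using this
    have hf : ∀ᶠ ε in 𝓝[>] (0 : ℝ), ∀ N ∈ Finset.range N₀, g ε N < η / 2 := by
      refine (eventually_all_finset (Finset.range N₀)).mpr fun N _ => ?_
      have hn : 2 ≤ max N 2 := le_max_right _ _
      have h0 : Tendsto (fun ε => g ε N) (𝓝[>] 0) (𝓝 0) := by
        have hr : Tendsto (r (max N 2)) (𝓝[>] (0 : ℝ)) (𝓝 (r (max N 2) 0)) :=
          to_right (hcont (max N 2) hn 0 h0mem)
        have := (hr.sub_const (r (max N 2) 0)).abs
        simpa [hg] using this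
      have := (Metric.tendsto_nhds.mp h0) (η / 2) (by positivity)
      simpa only [Real.dist_eq, sub_zero, abs_of_nonneg (g_nonneg _ N)] using this
    have h2 : ∀ᶠ ε in 𝓝[>] (0 : ℝ), ε ≤ 1 := mem_nhdsWithin_of_mem_nhds (Iic_mem_nhds one_pos)
    have h3 : ∀ᶠ ε in 𝓝[>] (0 : ℝ), 0 < ε := self_mem_nhdsWithin
    filter_upwards [hc, hf, h2, h3] with ε hcε hfε hε1 hε
    have hεm : ε ∈ Set.Icc (0 : ℝ) 1 := ⟨hε.le, hε1⟩
    have hall : ∀ N, g ε N ≤ η / 2 := by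
      intro N
      rcases lt_or_ge N N₀ with hN | hN
      · exact (hfε N (Finset.mem_range.mpr hN)).le
      · have := hN₀ N hN ε hεm
        linarith
    have hsup : (⨆ N, g ε N) ≤ η / 2 := ciSup_le hall
    have hsup0 : 0 ≤ ⨆ N, g ε N := le_ciSup_of_le (hbdd ε hεm) 0 (g_nonneg ε 0)
    rw [Real.dist_eq, sub_zero, abs_of_nonneg hsup0]
    linarith
  · -- the bound itself
    have hεm : ε ∈ Set.Icc (0 : ℝ) 1 := ⟨hε.le, hε1⟩
    rw [← g_eq N hN ε]
    exact le_ciSup (hbdd ε hεm) N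

/-! ## Stub 2 is load-bearing (triage r1-2's mutation, kernel-checked)

Without continuity of `r N` at `ε = 0` the transfer fails: `r_N(ε) := 1` at `ε = 0`, `0` on
`(0,1]` obeys the two-sided series law with `C = 1`, yet `|r_N(ε) − r_N(0)| = 1` for every `ε > 0`. -/

/-- The series law alone (no continuity in the noise at fixed `N`) does not give a modulus. [folklore] -/
theorem seriesLaw_without_continuity_insufficient :
    ∃ (r : ℕ → ℝ → ℝ) (C : ℝ),
      (∀ ε ∈ Set.Icc (0 : ℝ) 1, ∀ N M : ℕ, 2 ≤ N → 2 ≤ M →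
        |((N : ℝ) + (M : ℝ) - 1) * r (N + M) ε - ((N : ℝ) - 1) * r N ε - ((M : ℝ) - 1) * r M ε| ≤ C) ∧
      ¬ ∃ w : ℝ → ℝ, Filter.Tendsto w (nhdsWithin 0 (Set.Ioi 0)) (nhds 0) ∧
          ∀ N : ℕ, 2 ≤ N → ∀ ε : ℝ, 0 < ε → ε ≤ 1 → |r N ε - r N 0| ≤ w ε := by
  refine ⟨fun _ ε => if ε = 0 then 1 else 0, 1, ?_, ?_⟩
  · intro ε _ N M _ _
    by_cases h : ε = 0
    · subst h
      have e : ((N : ℝ) + (M : ℝ) - 1) * 1 - ((N : ℝ) - 1) * 1 - ((M : ℝ) - 1) * 1 = 1 := by ring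
      simp only [if_true, e, abs_one, le_refl]
    · simp [h]
  · rintro ⟨w, hw, hb⟩
    have h1 : ∀ᶠ ε in nhdsWithin (0 : ℝ) (Set.Ioi 0), w ε < 1 := by
      filter_upwards [(Metric.tendsto_nhds.mp hw) 1 one_pos] with ε hε
      rw [Real.dist_eq, sub_zero] at hε
      exact (le_abs_self _).trans_lt hε
    have h2 : ∀ᶠ ε in nhdsWithin (0 : ℝ) (Set.Ioi 0), ε ≤ 1 :=
      mem_nhdsWithin_of_mem_nhds (Iic_mem_nhds one_pos)
    have h3 : ∀ᶠ ε in nhdsWithin (0 : ℝ) (Set.Ioi 0), 0 < ε := self_mem_nhdsWithin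
    obtain ⟨ε, hε1, hε2, hε3⟩ := (h1.and (h2.and h3)).exists
    have hε0 : ε ≠ 0 := hε3.ne'
    have := hb 2 le_rfl ε hε3 hε2
    simp only [hε0, if_false, if_true, zero_sub, abs_neg, abs_one] at this
    linarith

/-! ## Small lemmas for the composition (proved) -/

/-- Along `𝓝[≠] 0` the response quotient of a currentless chain tends only to `0`. [folklore] -/
theorem response_eq_zero_of_le_one (P : OscillatorChain) {N : ℕ} (hN : N ≤ 1)
    (μ : ℝ → ℝ → Measure (PhaseSpace N)) (T D : ℝ)
    (hD : Tendsto (fun δ : ℝ => P.totalCurrent (μ (T + δ / 2) (T - δ / 2)) / δ) (𝓝[≠] 0) (𝓝 D)) :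
    D = 0 := by
  have h0 : Tendsto (fun δ : ℝ => P.totalCurrent (μ (T + δ / 2) (T - δ / 2)) / δ) (𝓝[≠] 0) (𝓝 0) := by
    simp only [Summit.AtomisticToContinuum.FouriersLaw.Theorems.totalCurrent_eq_zero_of_le_one P hN, zero_div]
    exact tendsto_const_nhds
  exact tendsto_nhds_unique hD h0

/-- **Closure step** (why no `ε = 0` stub is needed): a bound for a function continuous on `[0,1]` that
holds on `(0,1]` holds at `0`. [folklore] -/
theorem abs_le_of_abs_le_Ioc {F : ℝ → ℝ} {C : ℝ} (hF : ContinuousOn F (Set.Icc 0 1))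
    (h : ∀ ε ∈ Set.Ioc (0 : ℝ) 1, |F ε| ≤ C) : |F 0| ≤ C := by
  have h0 : (0 : ℝ) ∈ Set.Icc (0 : ℝ) 1 := ⟨le_rfl, zero_le_one⟩
  have ht : Tendsto (fun ε => |F ε|) (𝓝[Set.Ioc (0 : ℝ) 1] 0) (𝓝 |F 0|) :=
    (continuous_abs.tendsto _).comp
      ((hF 0 h0).tendsto.mono_left (nhdsWithin_mono _ Set.Ioc_subset_Icc_self))
  haveI : (𝓝[Set.Ioc (0 : ℝ) 1] 0).NeBot := by
    rw [nhdsWithin_Ioc_eq_nhdsGT zero_lt_one]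
    infer_instance
  exact le_of_tendsto ht (eventually_mem_nhdsWithin.mono h)


/-- Registered helper sub-goal `helper_equicontinuityOfSeriesLaw` of crux stmt-AtomisticToContinuum-11975 (line
`fekete-transposed-uniformity`; gen-1's `stub_equicontinuityOfSeriesLaw`, proved by the gen-2 planner) = `equicontinuity_of_seriesLaw`
in registry form. [folklore] -/
theorem helper_equicontinuityOfSeriesLaw : ∀ (r : ℕ → ℝ → ℝ) (C : ℝ), (∀ N : ℕ, 2 ≤ N → ContinuousOn (r N) (Set.Icc 0 1)) → (∀ ε ∈ Set.Icc (0 : ℝ) 1, ∀ N M : ℕ, 2 ≤ N → 2 ≤ M → |((N : ℝ) + (M : ℝ) - 1) * r (N + M) ε - ((N : ℝ) - 1) * r N ε - ((M : ℝ) - 1) * r M ε| ≤ C) → ∃ w : ℝ → ℝ, Filter.Tendsto w (nhdsWithin 0 (Set.Ioi 0)) (nhds 0) ∧ ∀ N : ℕ, 2 ≤ N → ∀ ε : ℝ, 0 < ε → ε ≤ 1 → |r N ε - r N 0| ≤ w ε :=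
  equicontinuity_of_seriesLaw

end Summit.AtomisticToContinuum.FouriersLaw.Theorems.NoiseLocality.FeketeReduction

end
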